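import Summits.HubbardSuperconductivity.HubbardSuperconductivity.Theorems.AnisotropyChordTransferFibre3OneLoop

/-!
# Route `AnisotropyChord` / H0 rotor rung: the one-loop identity layer of PartN31, part 3 — `VResidualPairing` (`L ≥ 3`)

Memo ROTOR-THEORY-21 §297(C) (theory seat `hubbard-h0-rotor-theory-1`), typed as `VResidualPairing` in `…Fibre3BetaFreeTargets`:
`⟨v, R′⟩ = −⟨v,Ψ¹⟩·T⁺ + (1−Δ)·Σ_c |v(c)|² W(c) Π⁰(c)` — the `v`-pairing of the off-`D` residual of the trial state `Ψ¹ = vΠ⁰` is a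
CONTACT sum (**`vResidualPairing_holds (hL : 3 ≤ L)`**).  Proof: `R′ = (H₀ − E)Ψ¹ − 1_D(H₀Ψ¹) − ΔWΨ¹`; `⟨v,(H₀−E)Ψ¹⟩ = −T⁺⟨v,Ψ¹⟩`
(`v` is a free eigenvector, `ip_vfun_H0apply`); and the hard-core term is `Σ_D conj(v)·H₀Ψ¹ = −Σ_c |v(c)|² W(c) Π⁰(c)`: the `2W(c)`
hops from an off-core configuration `c` into `D` carry the amplitudes `conj v(d)·e^{iK₁·e}` which add up to exactly `2W(c)·conj v(c)`
(`Bsum_offD`, the same pairwise phase bookkeeping as in the IMS formula).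
Prover seat `hubbard-h0-rotor-p1` g22; helper for stmt-HubbardSuperconductivity-19089 (`--supports`).
-/

set_option linter.dupNamespace false
set_option autoImplicit false

noncomputable section

open scoped BigOperators
open Complex

namespace Summit.HubbardSuperconductivity.HubbardSuperconductivity.Theorems.AnisotropyChord.Transfer.Fibre3

variable (L : ℕ) [NeZero L]

/-! ## The boundary amplitude of an off-core configuration -/

/-- amplitude, per hopping direction `e`, with which `c` is reached from the hard core, weighted by `conj v` at the source. [folklore] -/
def Bdir (e : Tor L) (c : Cfg L) : ℂ :=
  (Dind L (c.1 - e, c.2) : ℂ) * (starRingEnd ℂ) (vfun L (c.1 - e, c.2))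
    + (Dind L (c.1, c.2 - e) : ℂ) * (starRingEnd ℂ) (vfun L (c.1, c.2 - e))
    + phase L (K1 L) e * ((Dind L (c.1 + e, c.2 + e) : ℂ) * (starRingEnd ℂ) (vfun L (c.1 + e, c.2 + e)))

/-- the total boundary amplitude over the four directions. [folklore] -/
def Bsum (c : Cfg L) : ℂ := Bdir L (ex L) c + Bdir L (-ex L) c + Bdir L (ey L) c + Bdir L (-ey L) c

/-! ## Reindexing the hard-core sum -/

/-- one direction: `Σ_d 1_D(d) conj v(d) · hopT_e Ψ(d) = Σ_c Ψ(c) · Bdir_e(c)`. [folklore] -/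
theorem sum_D_hopT (Ψ : Cfg L → ℂ) (e : Tor L) :
    ∑ d : Cfg L, (Dind L d : ℂ) * (starRingEnd ℂ) (vfun L d) * hopT L (K1 L) Ψ d e
      = ∑ c : Cfg L, Ψ c * Bdir L e c := by
  unfold hopT Bdir
  simp only [mul_add, Finset.sum_add_distrib]
  congr 1
  congr 1
  · refine Fintype.sum_equiv (Equiv.addRight ((e, 0) : Cfg L)) _ _ fun d => ?_
    obtain ⟨a, b⟩ := d
    simp only [Equiv.coe_addRight, Prod.mk_add_mk, add_zero, add_sub_cancel_right]
    ring
  · refine Fintype.sum_equiv (Equiv.addRight ((0, e) : Cfg L)) _ _ fun d => ?_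
    obtain ⟨a, b⟩ := d
    simp only [Equiv.coe_addRight, Prod.mk_add_mk, add_zero, add_sub_cancel_right]
    ring
  · refine Fintype.sum_equiv (Equiv.addRight ((-e, -e) : Cfg L)) _ _ fun d => ?_
    obtain ⟨a, b⟩ := d
    simp only [Equiv.coe_addRight, Prod.mk_add_mk, ← sub_eq_add_neg]
    ring

/-- **the hard-core part of `⟨v, H₀Ψ⟩`** for `Ψ` vanishing on `D`: `Σ_{d∈D} conj v(d) (H₀Ψ)(d) = −½ Σ_c Ψ(c) Bsum(c)`. [folklore] -/
theorem sum_D_H0apply (Ψ : Cfg L → ℂ) (hΨ : ∀ c, InD L c = true → Ψ c = 0) :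
    ∑ d : Cfg L, (Dind L d : ℂ) * (starRingEnd ℂ) (vfun L d) * H0apply L (K1 L) Ψ d
      = -(1 / 2 : ℂ) * ∑ c : Cfg L, Ψ c * Bsum L c := by
  have hpt : ∀ d : Cfg L, (Dind L d : ℂ) * (starRingEnd ℂ) (vfun L d) * H0apply L (K1 L) Ψ d
      = -(1 / 2 : ℂ) * ((Dind L d : ℂ) * (starRingEnd ℂ) (vfun L d) * hopT L (K1 L) Ψ d (ex L)
          + (Dind L d : ℂ) * (starRingEnd ℂ) (vfun L d) * hopT L (K1 L) Ψ d (-ex L)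
          + (Dind L d : ℂ) * (starRingEnd ℂ) (vfun L d) * hopT L (K1 L) Ψ d (ey L)
          + (Dind L d : ℂ) * (starRingEnd ℂ) (vfun L d) * hopT L (K1 L) Ψ d (-ey L)) := by
    intro d
    rw [H0apply_four]
    by_cases hd : InD L d = true
    · rw [hΨ d hd]; ring
    · have : Dind L d = 0 := by unfold Dind; simp [hd]
      rw [this]; push_cast; ring
  rw [Finset.sum_congr rfl fun d _ => hpt d, ← Finset.mul_sum, Finset.sum_add_distrib, Finset.sum_add_distrib,
    Finset.sum_add_distrib, sum_D_hopT, sum_D_hopT, sum_D_hopT, sum_D_hopT]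
  congr 1
  unfold Bsum
  simp only [mul_add, Finset.sum_add_distrib]

/-! ## The boundary amplitude off the hard core equals `2W(c)·conj v(c)` -/

omit [NeZero L] in
/-- a sum over the four directions of a one-point indicator is the nearest-neighbour indicator (`L ≥ 3`). [folklore] -/
theorem four_ite (hL : 3 ≤ L) (x : Tor L) (g : Tor L → ℂ) :
    (if ex L = x then g (ex L) else 0) + (if -ex L = x then g (-ex L) else 0)
      + (if ey L = x then g (ey L) else 0) + (if -ey L = x then g (-ey L) else 0)
      = if IsNN L x = true then g x else 0 := by
  obtain ⟨d1, d2, d3, d4, d5, d6⟩ := nn_distinct L hL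
  by_cases hx : IsNN L x = true
  · rw [if_pos hx]
    rcases eq_of_isNN L hx with rfl | rfl | rfl | rfl
    · simp [d1.symm, d2.symm, d3.symm]
    · rw [if_neg d1, if_pos rfl, if_neg (Ne.symm d4), if_neg (Ne.symm d5)]; ring
    · rw [if_neg d2, if_neg d4, if_pos rfl, if_neg (Ne.symm d6)]; ring
    · rw [if_neg d3, if_neg d5, if_neg d6, if_pos rfl]; ring
  · rw [if_neg hx]
    have h1 : ex L ≠ x := fun h => hx (by rw [← h]; exact isNN_ex L)
    have h2 : -ex L ≠ x := fun h => hx (by rw [← h, IsNN_neg]; exact isNN_ex L)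
    have h3 : ey L ≠ x := fun h => hx (by rw [← h]; exact isNN_ey L)
    have h4 : -ey L ≠ x := fun h => hx (by rw [← h, IsNN_neg]; exact isNN_ey L)
    rw [if_neg h1, if_neg h2, if_neg h3, if_neg h4]; ring

omit [NeZero L] in
/-- hard-core membership of a type-1 neighbour of an off-core configuration. [folklore] -/
theorem Dind_type1 {a b : Tor L} (hb : b ≠ 0) (e : Tor L) :
    (Dind L (a - e, b) : ℂ) = (if e = a then 1 else 0) + (if e = a - b then 1 else 0) := by
  unfold Dind InD
  by_cases h1 : e = a
  · have h2 : e ≠ a - b := fun h => hb (by rw [h1] at h; linear_combination h)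
    rw [if_pos h1, if_neg h2]; subst h1; simp
  · by_cases h2 : e = a - b
    · rw [if_neg h1, if_pos h2]
      have : a - e = b := by rw [h2]; abel
      simp [this]
    · rw [if_neg h1, if_neg h2]
      have ha : a - e ≠ 0 := fun h => h1 (by linear_combination -h)
      have hab : a - e ≠ b := fun h => h2 (by linear_combination -h)
      simp [ha, hb, hab]

omit [NeZero L] in
/-- hard-core membership of a type-2 neighbour. [folklore] -/
theorem Dind_type2 {a b : Tor L} (ha : a ≠ 0) (e : Tor L) :
    (Dind L (a, b - e) : ℂ) = (if e = b then 1 else 0) + (if e = b - a then 1 else 0) := by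
  unfold Dind InD
  by_cases h1 : e = b
  · have h2 : e ≠ b - a := fun h => ha (by rw [h1] at h; linear_combination h)
    rw [if_pos h1, if_neg h2]; subst h1; simp [ha]
  · by_cases h2 : e = b - a
    · rw [if_neg h1, if_pos h2]
      have : b - e = a := by rw [h2]; abel
      simp [this, ha]
    · rw [if_neg h1, if_neg h2]
      have hb : b - e ≠ 0 := fun h => h1 (by linear_combination -h)
      have hab : a ≠ b - e := fun h => h2 (by linear_combination h)
      simp [ha, hb, hab]

omit [NeZero L] in
/-- hard-core membership of a type-3 (diagonal) neighbour. [folklore] -/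
theorem Dind_type3 {a b : Tor L} (hab : a ≠ b) (e : Tor L) :
    (Dind L (a + e, b + e) : ℂ) = (if e = -a then 1 else 0) + (if e = -b then 1 else 0) := by
  unfold Dind InD
  have hne : a + e ≠ b + e := fun h => hab (by linear_combination h)
  by_cases h1 : e = -a
  · have h2 : e ≠ -b := fun h => hab (by rw [h1] at h; linear_combination -h)
    rw [if_pos h1, if_neg h2]
    have : a + e = 0 := by rw [h1]; abel
    simp [this]
  · by_cases h2 : e = -b
    · rw [if_neg h1, if_pos h2]
      have : b + e = 0 := by rw [h2]; abel
      simp [this]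
    · rw [if_neg h1, if_neg h2]
      have ha : a + e ≠ 0 := fun h => h1 (by linear_combination h)
      have hb : b + e ≠ 0 := fun h => h2 (by linear_combination h)
      simp [ha, hb, hne]

/-- `conj v(x,y) = 1 + e^{−iK₁x} + e^{−iK₁y}`. [folklore] -/
theorem conj_vfun (c : Cfg L) :
    (starRingEnd ℂ) (vfun L c) = 1 + phase L (K1 L) (-c.1) + phase L (K1 L) (-c.2) := by
  unfold vfun; rw [map_add, map_add, map_one, conj_phase, conj_phase]

/-- **the boundary amplitude off the hard core:** `Bsum(c) = 2W(c)·conj v(c)` (`L ≥ 3`). [folklore] -/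
theorem Bsum_offD (hL : 3 ≤ L) (c : Cfg L) (hc : InD L c = false) :
    Bsum L c = 2 * (Wcount L c : ℂ) * (starRingEnd ℂ) (vfun L c) := by
  obtain ⟨a, b⟩ := c
  have hD : (¬(a = 0) ∧ ¬(b = 0)) ∧ ¬(a = b) := by unfold InD at hc; simpa using hc
  obtain ⟨⟨ha, hb⟩, hab⟩ := hD
  -- the three types, each summed over the four directions
  have T1 : ∀ e : Tor L, (Dind L (a - e, b) : ℂ) * (starRingEnd ℂ) (vfun L (a - e, b))
      = (if e = a then (starRingEnd ℂ) (vfun L (a - e, b)) else 0)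
        + (if e = a - b then (starRingEnd ℂ) (vfun L (a - e, b)) else 0) := by
    intro e; rw [Dind_type1 L hb]; split_ifs <;> ring
  have T2 : ∀ e : Tor L, (Dind L (a, b - e) : ℂ) * (starRingEnd ℂ) (vfun L (a, b - e))
      = (if e = b then (starRingEnd ℂ) (vfun L (a, b - e)) else 0)
        + (if e = b - a then (starRingEnd ℂ) (vfun L (a, b - e)) else 0) := by
    intro e; rw [Dind_type2 L ha]; split_ifs <;> ring
  have T3 : ∀ e : Tor L, phase L (K1 L) e * ((Dind L (a + e, b + e) : ℂ) * (starRingEnd ℂ) (vfun L (a + e, b + e)))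
      = (if e = -a then phase L (K1 L) e * (starRingEnd ℂ) (vfun L (a + e, b + e)) else 0)
        + (if e = -b then phase L (K1 L) e * (starRingEnd ℂ) (vfun L (a + e, b + e)) else 0) := by
    intro e; rw [Dind_type3 L hab]; split_ifs <;> ring
  have S1 := four_ite L hL a (fun e => (starRingEnd ℂ) (vfun L (a - e, b)))
  have S1' := four_ite L hL (a - b) (fun e => (starRingEnd ℂ) (vfun L (a - e, b)))
  have S2 := four_ite L hL b (fun e => (starRingEnd ℂ) (vfun L (a, b - e)))
  have S2' := four_ite L hL (b - a) (fun e => (starRingEnd ℂ) (vfun L (a, b - e)))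
  have S3 := four_ite L hL (-a) (fun e => phase L (K1 L) e * (starRingEnd ℂ) (vfun L (a + e, b + e)))
  have S3' := four_ite L hL (-b) (fun e => phase L (K1 L) e * (starRingEnd ℂ) (vfun L (a + e, b + e)))
  have hB : Bsum L (a, b)
      = (if IsNN L a = true then (starRingEnd ℂ) (vfun L (a - a, b)) else 0)
        + (if IsNN L (a - b) = true then (starRingEnd ℂ) (vfun L (a - (a - b), b)) else 0)
        + ((if IsNN L b = true then (starRingEnd ℂ) (vfun L (a, b - b)) else 0)
          + (if IsNN L (b - a) = true then (starRingEnd ℂ) (vfun L (a, b - (b - a))) else 0))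
        + ((if IsNN L (-a) = true then phase L (K1 L) (-a) * (starRingEnd ℂ) (vfun L (a + -a, b + -a)) else 0)
          + (if IsNN L (-b) = true then phase L (K1 L) (-b) * (starRingEnd ℂ) (vfun L (a + -b, b + -b)) else 0)) := by
    rw [← S1, ← S1', ← S2, ← S2', ← S3, ← S3']
    unfold Bsum Bdir
    simp only
    rw [T1, T1, T1, T1, T2, T2, T2, T2, T3, T3, T3, T3]
    ring
  rw [hB]
  -- phase algebra: each flag contributes `2 conj v(a,b)`
  simp only [sub_self, sub_sub_cancel, add_neg_cancel, IsNN_neg, conj_vfun, neg_zero, phase_zero]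
  rw [show a - b = -(b - a) by abel, IsNN_neg]
  have e1 : phase L (K1 L) (-a) * (1 + 1 + phase L (K1 L) (-(b + -a)))
      = 2 * phase L (K1 L) (-a) + phase L (K1 L) (-b) := by
    rw [show -(b + -a) = a + -b by abel, mul_add, ← phase_add, show -a + (a + -b) = -b by abel]; ring
  have e2 : phase L (K1 L) (-b) * (1 + phase L (K1 L) (-(a + -b)) + 1)
      = 2 * phase L (K1 L) (-b) + phase L (K1 L) (-a) := by
    rw [show -(a + -b) = b + -a by abel, mul_add, mul_add, ← phase_add, show -b + (b + -a) = -a by abel]; ring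
  rw [e1, e2]
  unfold Wcount
  simp only
  rw [show b - a = b - a from rfl]
  by_cases h1 : IsNN L a = true <;> by_cases h2 : IsNN L b = true <;> by_cases h3 : IsNN L (b - a) = true <;>
    simp [h1, h2, h3] <;> ring

/-! ## The pairing -/

/-- **`VResidualPairing` holds for `L ≥ 3`.** [folklore] -/
theorem vResidualPairing_holds (hL : 3 ≤ L) (Δ lam2 : ℝ) : VResidualPairing L Δ lam2 := by
  intro f hf
  have hL2 : 2 ≤ L := by omega
  set Ψ := trialK1 L f with hΨ
  set T := Tplus L Δ f with hT
  have hD : ∀ c, InD L c = true → Ψ c = 0 := trialK1_D L hf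
  -- pointwise decomposition of conj(v)·R′
  have hpt : ∀ c : Cfg L, (starRingEnd ℂ) (vfun L c) * resid L Δ f c
      = (starRingEnd ℂ) (vfun L c) * (H0apply L (K1 L) Ψ c - ((eps1 L + T : ℝ) : ℂ) * Ψ c)
        - (Dind L c : ℂ) * (starRingEnd ℂ) (vfun L c) * H0apply L (K1 L) Ψ c
        - (Δ : ℂ) * ((Complex.normSq (vfun L c) : ℂ) * (Wcount L c : ℂ) * prodState L f c) := by
    intro c
    show (starRingEnd ℂ) (vfun L c) * residual L T Δ Ψ c = _
    unfold residual Happly Dind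
    by_cases hc : InD L c = true
    · simp only [hc, if_true]
      rw [hD c hc]
      have : prodState L f c = 0 := prodState_D L hf c hc
      rw [this]; push_cast; ring
    · simp only [hc, Bool.false_eq_true, if_false]
      rw [Complex.normSq_eq_conj_mul_self, hΨ]
      unfold trialK1
      push_cast; ring
  unfold ip
  rw [Finset.sum_congr rfl fun c _ => hpt c, Finset.sum_sub_distrib, Finset.sum_sub_distrib, ← Finset.mul_sum,
    sum_D_H0apply L Ψ hD]
  -- ⟨v, (H₀ − E)Ψ⟩ = −T⟨v,Ψ⟩
  have h1 : ∑ c : Cfg L, (starRingEnd ℂ) (vfun L c) * (H0apply L (K1 L) Ψ c - ((eps1 L + T : ℝ) : ℂ) * Ψ c)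
      = -(ip L (vfun L) Ψ) * (T : ℂ) := by
    have e : ∑ c : Cfg L, (starRingEnd ℂ) (vfun L c) * (H0apply L (K1 L) Ψ c - ((eps1 L + T : ℝ) : ℂ) * Ψ c)
        = ip L (vfun L) (H0apply L (K1 L) Ψ) - ((eps1 L + T : ℝ) : ℂ) * ip L (vfun L) Ψ := by
      unfold ip; rw [Finset.mul_sum, ← Finset.sum_sub_distrib]
      refine Finset.sum_congr rfl fun c _ => ?_; ring
    rw [e, ip_vfun_H0apply L hL2]; push_cast; ring
  -- the hard-core term
  have h2 : ∑ c : Cfg L, Ψ c * Bsum L c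
      = 2 * ∑ c : Cfg L, (Complex.normSq (vfun L c) : ℂ) * (Wcount L c : ℂ) * prodState L f c := by
    rw [Finset.mul_sum]
    refine Finset.sum_congr rfl fun c _ => ?_
    by_cases hc : InD L c = true
    · rw [hD c hc, prodState_D L hf c hc]; ring
    · have hc' : InD L c = false := by simpa using hc
      rw [Bsum_offD L hL c hc', Complex.normSq_eq_conj_mul_self, hΨ]
      unfold trialK1
      ring
  rw [h1, h2]
  unfold ip
  push_cast
  ring

end Summit.HubbardSuperconductivity.HubbardSuperconductivity.Theorems.AnisotropyChord.Transfer.Fibre3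

end
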